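import Summits.CriticalPhenomena.SAWScalingLimit.Theorems.SAWDevelopingMapHexConjectureKPExplicitExponent
import Literature.Probability.RandomPlanarGeometry.HexSAWHammersleyWelshExplicit
import Literature.Probability.RandomPlanarGeometry.HexSAWTheorem1
import HarnessLib

/-!
# Crux `HexConjecture` (stmt-CriticalPhenomena-0808), line `root-locality-replaces-loewner`:
an UNCONDITIONAL sub-Hammersley–Welsh bound on the honeycomb lattice,
`c_n(ℍ) ≤ A · exp(K · n^{1/2 − ε}) · μ_ℍⁿ` for every `n ≥ 1`, with `ε = 7/3999999986` explicit

Landing target: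
`Summits/CriticalPhenomena/SAWScalingLimit/Theorems/HexHWStretchedFromKPExplicit.lean`
(`--supports stmt-CriticalPhenomena-0808`; lane «pcv-sawmu», seat a-p4; Summits side because the
input `KPExplicit.stripBlim_decay_explicit` lives here and Literature may not import Summits).

Composition of two tree theorems, no named fact, no hypothesis:

* `KPExplicit.stripBlim_decay_explicit` (`…KPExplicitExponent.lean`, this line): Krachun–Panagiotis's
  Theorem 2 with an explicit exponent, `B_T = HV.stripBlim T ≤ 200 · T^{-7·10⁻⁹}` for every `T ≥ 1`
  (printed: D. Krachun, C. Panagiotis, *Quantitative sub-ballisticity of self-avoiding walk on the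
  hexagonal lattice*, arXiv:2310.17299, Theorem 2, p. 3: "Let `ε = 10^{-10}`. For every `T ≥ 1` we have
  `B_T ≤ 100 · T^{-ε}`");
* `hexHWStretched_of_bridgeDecay` (`Literature/…/HexSAWHammersleyWelshExplicit.lean`, lane route R55):
  the Hammersley–Welsh engine `BridgeDecay C η → ∃ A K, HexHWStretched A K ((1−η)/(2−η))`
  (J. M. Hammersley, D. J. A. Welsh, Quart. J. Math. Oxford 13 (1962) 108–110; H. Duminil-Copin,
  S. Smirnov, Ann. of Math. 175 (2012), §3).

Results (namespace `…HexConjecture.RootLocality.KPExplicit`):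

* `bridgeDecay_explicit : BridgeDecay 200 (7/10⁹)`;
* `hexHWStretched_explicit : ∃ A K, HexHWStretched A K ((1 − 7/10⁹)/(2 − 7/10⁹))`;
* `hexSawCount_le_exp_rpow` — `∃ A K, ∀ n ≥ 1, c_n(ℍ) ≤ A · exp(K · n^{1/2 − 7/3999999986}) · μ_ℍⁿ`,
  and the same with `μ_ℍ = √(2+√2)` substituted (Duminil-Copin–Smirnov's Theorem 1, tree theorem
  `DuminilCopinSmirnov2012_thm1_holds`): `hexSawCount_le_exp_rpow_sqrt`;
* **`hexSawCount_le_explicit` — for every `n ≥ 1`,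
  `c_n(ℍ) ≤ 15 · exp(500000 · n^{1/2 − 7/3999999986}) · (√(2+√2))ⁿ`** (NUMERALS: the engine with its
  constants in the statement, `hexHWStretched_explicit_of_bridgeDecay`, gives `A = 8μ_ℍ ≤ 15` and
  `K = 1 + 128 μ_ℍ³ · 200 · (2^{1−η}/(1−η) + 1) ≤ 5·10⁵`, certified in-kernel from `μ_ℍ = √(2+√2) ≤ 1.8478`).

Printed comparison points and status (lane «pcv-sawmu» wording of record): H. Duminil-Copin, S. Ganguly,
A. Hammond, I. Manolescu, *Bounding the number of self-avoiding walks: Hammersley–Welsh with polygon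
insertion*, Ann. Probab. 48 (2020), Theorem 1.3 (arXiv:1809.00760 p. 3: "Let `ε ∈ (0, 1/42)`. Then, for
any `n ∈ ℕ` high enough, `|SAW_n(ℍ)| ≤ exp(n^{1/2−ε}) μ(ℍ)^n`") prints an `n^{1/2−ε}` exponent for EVERY
`ε < 1/42` — explicit and asymptotically FAR BETTER than the `ε = 7/3999999986 ≈ 1.75·10⁻⁹` here — with
constant `1` and only the threshold `n₀(ε)` inexplicit; T. Hutchcroft, *The Hammersley–Welsh bound for
self-avoiding walk revisited*, Electron. Commun. Probab. 23 (2018), Theorem 1.2 (arXiv:1708.09460 p. 3: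
"Let `d ≥ 2`. Then `c_n ≤ exp[o(n^{1/2})] μ_c^n` as `n → ∞`"), is inexplicit;
D. Krachun, C. Panagiotis (2026) print no `c_n` corollary of their Theorem 2. What this file adds is an
ALL-`n` statement (`n ≥ 1`) with `ε`, `A`, `K` as numerals, obtained by kernel composition of two tree
theorems (an independent route: Glazman–Manolescu/Krachun–Panagiotis bridge decay + the Hammersley–Welsh
product, no parafermionic polygon insertion) — an explicit INSTANCE, not a better exponent.
-/

noncomputable section

open Real
open Literature.Probability.RandomPlanarGeometry.SAW Literature.Probability.RandomPlanarGeometry.SAW.HV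

namespace Summit.CriticalPhenomena.SAWScalingLimit.Theorems.HexConjecture.RootLocality.KPExplicit

/-- Krachun–Panagiotis's Theorem 2 with the explicit exponent `7·10⁻⁹`, in the `BridgeDecay` shape of
`HexSAWHammersleyWelshExplicit.lean`: `B_T(x_c) ≤ 200 · T^{-7/10⁹}` for every `T ≥ 1`.
[cite: KrachunPanagiotis2026, Theorem 2 (p. 3; shape, exponent ours)] -/
theorem bridgeDecay_explicit : BridgeDecay 200 (7 / 10 ^ 9) :=
  fun T hT => stripBlim_decay_explicit T hT

/-- **Stretched Hammersley–Welsh on `ℍ`, unconditionally**: there are `A, K` with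
`c_n(ℍ) ≤ A · exp(K · n^θ) · μ_ℍⁿ` for every `n ≥ 1`, `θ = (1 − η)/(2 − η)`, `η = 7·10⁻⁹`
(the engine `hexHWStretched_of_bridgeDecay` fed with `bridgeDecay_explicit`).
[cite: KrachunPanagiotis2026, Theorem 2 and §1 (Hammersley–Welsh with polynomial bridge decay)] -/
theorem hexHWStretched_explicit :
    ∃ A K : ℝ, HexHWStretched A K ((1 - 7 / 10 ^ 9) / (2 - 7 / 10 ^ 9)) :=
  hexHWStretched_of_bridgeDecay (by norm_num) (by norm_num) (by norm_num) bridgeDecay_explicit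

/-- **`c_n(ℍ) ≤ A · exp(K · n^{1/2 − ε}) · μ_ℍⁿ` for every `n ≥ 1`, with `ε = 7/3999999986 = η/(2(2−η))`,
`η = 7·10⁻⁹`** — an unconditional sub-Hammersley–Welsh correction on the honeycomb lattice
(DGHM 2020 print `exp(n^{1/2−ε})`, `ε < 1/42`, for `n` large, constants inexplicit).
[cite: DuminilCopinGangulyHammondManolescu2020, Theorem 1.3 (p. 3; shape)] -/
theorem hexSawCount_le_exp_rpow :
    ∃ A K : ℝ, ∀ n : ℕ, 1 ≤ n →
      (hexSawCount n : ℝ) ≤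
        A * Real.exp (K * (n : ℝ) ^ ((1 : ℝ) / 2 - 7 / 3999999986)) * hexConnectiveConstant ^ n := by
  obtain ⟨A, K, h⟩ := hexHWStretched_explicit
  refine ⟨A, K, fun n hn => ?_⟩
  have e : ((1 : ℝ) - 7 / 10 ^ 9) / (2 - 7 / 10 ^ 9) = (1 : ℝ) / 2 - 7 / 3999999986 := by norm_num
  have := h n hn
  rwa [e] at this

/-- The same bound with Duminil-Copin–Smirnov's value `μ_ℍ = √(2+√2)` substituted:
`c_n(ℍ) ≤ A · exp(K · n^{1/2 − 7/3999999986}) · (√(2+√2))ⁿ` for every `n ≥ 1`.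
[cite: DuminilCopinSmirnov2012, Theorem 1] -/
theorem hexSawCount_le_exp_rpow_sqrt :
    ∃ A K : ℝ, ∀ n : ℕ, 1 ≤ n →
      (hexSawCount n : ℝ) ≤
        A * Real.exp (K * (n : ℝ) ^ ((1 : ℝ) / 2 - 7 / 3999999986)) *
          Real.sqrt (2 + Real.sqrt 2) ^ n := by
  rw [← hexConnectiveConstant_eq_of_thm1 DuminilCopinSmirnov2012_thm1_holds]
  exact hexSawCount_le_exp_rpow

/-- **Fully explicit and unconditional**: for every `n ≥ 1`,
`c_n(ℍ) ≤ 15 · exp(500000 · n^{1/2 − 7/3999999986}) · (√(2+√2))ⁿ`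
(the engine with its constants in the statement, `hexHWStretched_explicit_of_bridgeDecay`, at
`C = 200`, `η = 7·10⁻⁹`: `A = 8μ_ℍ ≤ 15` and `K = 1 + 128 μ_ℍ³ · 200 · (2^{1−η}/(1−η) + 1) ≤ 5·10⁵`,
using `μ_ℍ = √(2+√2) ≤ 1.8478`). Printed comparison: DGHM 2020 Theorem 1.3 has `exp(n^{1/2−ε}) μⁿ` for
every `ε < 1/42` (far better exponent, constant `1`) but only for `n ≥ n₀(ε)` with `n₀` inexplicit; here
every `n ≥ 1`, all three constants numerals.
[cite: DuminilCopinGangulyHammondManolescu2020, Theorem 1.3 (p. 3; shape — there ε < 1/42, n ≥ n₀(ε))] -/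
theorem hexSawCount_le_explicit (n : ℕ) (hn : 1 ≤ n) :
    (hexSawCount n : ℝ) ≤
      15 * Real.exp (500000 * (n : ℝ) ^ ((1 : ℝ) / 2 - 7 / 3999999986)) *
        Real.sqrt (2 + Real.sqrt 2) ^ n := by
  have h := hexHWStretched_explicit_of_bridgeDecay (C := 200) (η := 7 / 10 ^ 9)
    (by norm_num) (by norm_num) (by norm_num) bridgeDecay_explicit n hn
  have e : ((1 : ℝ) - 7 / 10 ^ 9) / (2 - 7 / 10 ^ 9) = (1 : ℝ) / 2 - 7 / 3999999986 := by norm_num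
  rw [e, hexConnectiveConstant_eq_of_thm1 DuminilCopinSmirnov2012_thm1_holds] at h
  set μ := Real.sqrt (2 + Real.sqrt 2) with hμ
  -- `μ ≤ 1.8478`
  have hs2 : Real.sqrt 2 ≤ 1.4143 := by
    rw [Real.sqrt_le_left (by norm_num)]; norm_num
  have hμle : μ ≤ 1.8478 := by
    rw [hμ, Real.sqrt_le_left (by norm_num)]; nlinarith
  have hμ0 : 0 ≤ μ := Real.sqrt_nonneg _
  have hA : 8 * μ ≤ 15 := by nlinarith
  have hμsq : μ ^ 2 = 2 + Real.sqrt 2 := by rw [hμ]; exact Real.sq_sqrt (by positivity)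
  have hμ3 : μ ^ 3 ≤ 6.31 := by
    have e3 : μ ^ 3 = μ * (2 + Real.sqrt 2) := by rw [← hμsq]; ring
    rw [e3]
    have hs0 : 0 ≤ Real.sqrt 2 := Real.sqrt_nonneg 2
    nlinarith [mul_le_mul hμle (show 2 + Real.sqrt 2 ≤ 3.4143 by linarith) (by positivity)
      (by norm_num : (0 : ℝ) ≤ 1.8478)]
  -- `2^{1−η} ≤ 2`, so `2^{1−η}/(1−η) + 1 ≤ 3.0001`
  have h2η : (2 : ℝ) ^ ((1 : ℝ) - 7 / 10 ^ 9) ≤ 2 := by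
    calc (2 : ℝ) ^ ((1 : ℝ) - 7 / 10 ^ 9) ≤ (2 : ℝ) ^ (1 : ℝ) :=
          Real.rpow_le_rpow_of_exponent_le (by norm_num) (by norm_num)
      _ = 2 := Real.rpow_one 2
  have h2η0 : 0 ≤ (2 : ℝ) ^ ((1 : ℝ) - 7 / 10 ^ 9) := Real.rpow_nonneg (by norm_num) _
  have hD : (2 : ℝ) ^ ((1 : ℝ) - 7 / 10 ^ 9) / (1 - 7 / 10 ^ 9) + 1 ≤ 3.0001 := by
    rw [div_add_one (by norm_num), div_le_iff₀ (by norm_num)]; nlinarith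
  have hD0 : 0 ≤ (2 : ℝ) ^ ((1 : ℝ) - 7 / 10 ^ 9) / (1 - 7 / 10 ^ 9) + 1 := by positivity
  have hK : 1 + 128 * μ ^ 3 * 200 * ((2 : ℝ) ^ ((1 : ℝ) - 7 / 10 ^ 9) / (1 - 7 / 10 ^ 9) + 1) ≤
      500000 := by
    have hμ30 : 0 ≤ μ ^ 3 := pow_nonneg hμ0 3
    nlinarith [mul_le_mul hμ3 hD hD0 (by norm_num : (0:ℝ) ≤ 6.31)]
  have hnθ : 0 ≤ (n : ℝ) ^ ((1 : ℝ) / 2 - 7 / 3999999986) := Real.rpow_nonneg (Nat.cast_nonneg n) _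
  calc (hexSawCount n : ℝ)
      ≤ 8 * μ * Real.exp ((1 + 128 * μ ^ 3 * 200 *
          ((2 : ℝ) ^ ((1 : ℝ) - 7 / 10 ^ 9) / (1 - 7 / 10 ^ 9) + 1)) *
            (n : ℝ) ^ ((1 : ℝ) / 2 - 7 / 3999999986)) * μ ^ n := h
    _ ≤ 15 * Real.exp (500000 * (n : ℝ) ^ ((1 : ℝ) / 2 - 7 / 3999999986)) * μ ^ n := by
        refine mul_le_mul_of_nonneg_right ?_ (pow_nonneg hμ0 n)
        exact mul_le_mul hA (Real.exp_le_exp.2 (mul_le_mul_of_nonneg_right hK hnθ))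
          (Real.exp_pos _).le (by norm_num)

end Summit.CriticalPhenomena.SAWScalingLimit.Theorems.HexConjecture.RootLocality.KPExplicit

end
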